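import Summits.AtomisticToContinuum.HydrodynamicLimit.Theses.SpeedCapSurgery

/-!
# Strategist sketch — crux `MaxSpeedBoundLog` (stmt-AtomisticToContinuum-9629)

Typed signatures used in `STRATEGY-CENSUS.md` (crux-strategist seat
planner-cstrat-stmt-AtomisticToContinuum-9629-s2-0, 2026-08-17). Nothing here is a route item;
these are the concrete objects of the four lenses (transfer / strengthen / decomposition /
negation). No `sorry`.
-/

namespace Summit.AtomisticToContinuum.HydrodynamicLimit.Cruxes.MaxSpeedBoundLog.Strategist

open MeasureTheory Filter Set Topology
open scoped ENNReal
open Literature.MathematicalPhysics.KineticTheory Literature.Analysis.FluidPDE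
open Summit.AtomisticToContinuum.HydrodynamicLimit.Theses.SpeedCapSurgery

/-! ## Decomposition lens, piece D2a / the refuters' recommended restatement -/

/-- PRE-SHOCK form of the crux (the frame in which `closes` actually consumes it): the
`C√log(N+2)` cap asserted only for `t ∈ [0,T)` along a classical hard-sphere Euler solution on
`[0,T)` matched by the local-Gibbs LLN at `t = 0` (cf. refuter evidence `W_Speed2.lean`,
`MaxSpeedBoundLogPreShock`; re-typed here because that evidence file is not mounted in this seat). -/
def MaxSpeedBoundLogPreShock : Prop :=
  ∀ (a₀ θ₀ : T3 → ℝ) (u₀ : T3 → V3), Continuous a₀ → Continuous θ₀ → Continuous u₀ →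
    (∀ x, 0 < a₀ x) → (∀ x, 0 < θ₀ x) →
    ∃ σ₀ : ℝ, 0 < σ₀ ∧ ∀ σ : ℝ, 0 < σ → σ < σ₀ →
      ∀ (T : ℝ) (ρ θ : ℝ → T3 → ℝ) (u : ℝ → T3 → V3), IsHardSphereEulerSolution σ T ρ u θ →
        ∀ Φ : (N : ℕ) → HardSphereFlow (Torus.geometry (Fin 3)) (hsDiameter σ N) (N + 1),
          TendstoHydroFieldsAt (fun N => localGibbsLaw σ a₀ u₀ θ₀ N (Φ N)) Φ ρ u θ 0 →
            ∀ t ∈ Ico 0 T, ∃ C : ℝ,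
              Tendsto (fun N : ℕ => localGibbsLaw σ a₀ u₀ θ₀ N (Φ N)
                {z | ∃ r ∈ Icc 0 t, ∃ i, C * Real.sqrt (Real.log ((N : ℝ) + 2)) < ‖((Φ N).flow r z i).2‖})
                atTop (𝓝 0)

/-- Nothing is lost: the crux as typed (all `t ≥ 0`, no Euler solution) implies its pre-shock form. -/
theorem preShock_of_maxSpeedBoundLog (h : MaxSpeedBoundLog) : MaxSpeedBoundLogPreShock := by
  intro a₀ θ₀ u₀ ha hθ hu ha0 hθ0
  obtain ⟨σ₀, hσ₀, H⟩ := h a₀ θ₀ u₀ ha hθ hu ha0 hθ0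
  refine ⟨σ₀, hσ₀, fun σ hσ hσ' T ρ θ u _ Φ _ t ht => ?_⟩
  exact H σ hσ hσ' t ht.1 Φ

/-- The route is still decided after the restatement: the deciding theorem with the pre-shock
form in place of the crux (same script as the route's `closes`; the only change is where `C` is
obtained). -/
theorem closes_preShock : MaxSpeedBoundLogPreShock → CappedEulerLimit → _root_.HydrodynamicLimit := by
  intro hMS hU
  obtain ⟨η₀, hη₀, hU⟩ := hU
  refine ⟨η₀, hη₀, ?_⟩
  intro a₀ θ₀ u₀ ha hθ hu ha0 hθ0
  obtain ⟨σ₁, hσ₁, h1⟩ := hMS a₀ θ₀ u₀ ha hθ hu ha0 hθ0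
  obtain ⟨σ₂, hσ₂, h2⟩ := hU a₀ θ₀ u₀ ha hθ hu ha0 hθ0
  refine ⟨min σ₁ σ₂, lt_min hσ₁ hσ₂, ?_⟩
  intro σ hσ hσlt T ρ θ u hsol hpack Φ h0 t ht
  obtain ⟨C, hC⟩ := h1 σ hσ (lt_of_lt_of_le hσlt (min_le_left _ _)) T ρ θ u hsol Φ h0 t ht
  have hUC := h2 σ hσ (lt_of_lt_of_le hσlt (min_le_right _ _)) T ρ θ u hsol hpack Φ h0 t ht C
  have key : ∀ A : (N : ℕ) → Set (Config (N + 1) (Fin 3) T3),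
      Tendsto (fun N : ℕ => (localGibbsLaw σ a₀ u₀ θ₀ N (Φ N)).restrict
        {z | ∀ r ∈ Icc 0 t, ∀ i, ‖((Φ N).flow r z i).2‖ ≤ C * Real.sqrt (Real.log ((N : ℝ) + 2))} (A N))
        atTop (𝓝 0) →
      Tendsto (fun N : ℕ => localGibbsLaw σ a₀ u₀ θ₀ N (Φ N) (A N)) atTop (𝓝 0) := by
    intro A hA
    have hsum := hA.add hC
    rw [add_zero] at hsum
    refine tendsto_of_tendsto_of_tendsto_of_le_of_le tendsto_const_nhds hsum (fun _ => zero_le) fun N => ?_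
    calc localGibbsLaw σ a₀ u₀ θ₀ N (Φ N) (A N)
        ≤ localGibbsLaw σ a₀ u₀ θ₀ N (Φ N)
            (A N ∩ {z | ∀ r ∈ Icc 0 t, ∀ i, ‖((Φ N).flow r z i).2‖ ≤ C * Real.sqrt (Real.log ((N : ℝ) + 2))} ∪
              A N \ {z | ∀ r ∈ Icc 0 t, ∀ i, ‖((Φ N).flow r z i).2‖ ≤ C * Real.sqrt (Real.log ((N : ℝ) + 2))}) := by
          refine measure_mono fun z hz => ?_
          by_cases hzs : z ∈ {z | ∀ r ∈ Icc 0 t, ∀ i, ‖((Φ N).flow r z i).2‖ ≤ C * Real.sqrt (Real.log ((N : ℝ) + 2))}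
          · exact Or.inl ⟨hz, hzs⟩
          · exact Or.inr ⟨hz, hzs⟩
      _ ≤ localGibbsLaw σ a₀ u₀ θ₀ N (Φ N)
            (A N ∩ {z | ∀ r ∈ Icc 0 t, ∀ i, ‖((Φ N).flow r z i).2‖ ≤ C * Real.sqrt (Real.log ((N : ℝ) + 2))}) +
          localGibbsLaw σ a₀ u₀ θ₀ N (Φ N)
            (A N \ {z | ∀ r ∈ Icc 0 t, ∀ i, ‖((Φ N).flow r z i).2‖ ≤ C * Real.sqrt (Real.log ((N : ℝ) + 2))}) :=
          measure_union_le _ _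
      _ ≤ (localGibbsLaw σ a₀ u₀ θ₀ N (Φ N)).restrict
            {z | ∀ r ∈ Icc 0 t, ∀ i, ‖((Φ N).flow r z i).2‖ ≤ C * Real.sqrt (Real.log ((N : ℝ) + 2))} (A N) +
          localGibbsLaw σ a₀ u₀ θ₀ N (Φ N)
            {z | ∃ r ∈ Icc 0 t, ∃ i, C * Real.sqrt (Real.log ((N : ℝ) + 2)) < ‖((Φ N).flow r z i).2‖} := by
          refine add_le_add (Measure.le_restrict_apply _ _) (measure_mono ?_)
          intro z hz
          have hz' := hz.2
          simp only [mem_setOf_eq, not_forall, not_le] at hz'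
          obtain ⟨r, hr, i, hi⟩ := hz'
          exact ⟨r, hr, i, hi⟩
  intro χ hχ δ hδ
  obtain ⟨hU1, hU2, hU3⟩ := hUC χ hχ δ hδ
  exact ⟨key _ hU1, key _ hU2, key _ hU3⟩

/-! ## Decomposition lens, the fixed-time core (piece D4a) and the strengthening S⁺2 -/

/-- FIXED-TIME CORE of the crux (weaker than the crux: the supremum over `r ≤ t` is OUTSIDE the
probability): the cap fails at each single time with probability `→ 0`, uniformly in `r ≤ t`. The
crux implies it (monotonicity); it is the piece every known argument reduces to a ONE-BODY velocity
tail at time `r` beyond the reach of relative entropy (census §Transfer T1, §Strengthen S⁺2). -/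
def FixedTimeCapLog : Prop :=
  ∀ (a₀ θ₀ : T3 → ℝ) (u₀ : T3 → V3), Continuous a₀ → Continuous θ₀ → Continuous u₀ →
    (∀ x, 0 < a₀ x) → (∀ x, 0 < θ₀ x) →
    ∃ σ₀ : ℝ, 0 < σ₀ ∧ ∀ σ : ℝ, 0 < σ → σ < σ₀ → ∀ t : ℝ, 0 ≤ t →
      ∀ Φ : (N : ℕ) → HardSphereFlow (Torus.geometry (Fin 3)) (hsDiameter σ N) (N + 1),
        ∃ C : ℝ, Tendsto (fun N : ℕ => ⨆ r ∈ Icc 0 t, localGibbsLaw σ a₀ u₀ θ₀ N (Φ N)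
          {z | ∃ i, C * Real.sqrt (Real.log ((N : ℝ) + 2)) < ‖((Φ N).flow r z i).2‖}) atTop (𝓝 0)

/-- The crux implies its fixed-time core. -/
theorem fixedTimeCapLog_of_maxSpeedBoundLog (h : MaxSpeedBoundLog) : FixedTimeCapLog := by
  intro a₀ θ₀ u₀ ha hθ hu ha0 hθ0
  obtain ⟨σ₀, hσ₀, H⟩ := h a₀ θ₀ u₀ ha hθ hu ha0 hθ0
  refine ⟨σ₀, hσ₀, fun σ hσ hσ' t ht Φ => ?_⟩
  obtain ⟨C, hC⟩ := H σ hσ hσ' t ht Φ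
  refine ⟨C, tendsto_of_tendsto_of_tendsto_of_le_of_le tendsto_const_nhds hC (fun _ => zero_le) fun N => ?_⟩
  refine iSup₂_le fun r hr => measure_mono fun z hz => ?_
  obtain ⟨i, hi⟩ := hz
  exact ⟨r, hr, i, hi⟩

/-- STRENGTHENING S⁺2 (one-body sub-Gaussian tail at the extreme-value level, uniformly in
`r ≤ t`): by exchangeability of the local Gibbs law along the flow this gives `FixedTimeCapLog` by a
union bound over the `N + 1` spheres; it is the ONE-LEVEL shadow of `GaussianVelocityTails`
(stmt-9633) and exactly what the barrier `HighMomentumCutoffBarrierNarrow` names as missing. -/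
def OneBodyTailAtLevel : Prop :=
  ∀ (a₀ θ₀ : T3 → ℝ) (u₀ : T3 → V3), Continuous a₀ → Continuous θ₀ → Continuous u₀ →
    (∀ x, 0 < a₀ x) → (∀ x, 0 < θ₀ x) →
    ∃ σ₀ : ℝ, 0 < σ₀ ∧ ∀ σ : ℝ, 0 < σ → σ < σ₀ → ∀ t : ℝ, 0 ≤ t →
      ∀ Φ : (N : ℕ) → HardSphereFlow (Torus.geometry (Fin 3)) (hsDiameter σ N) (N + 1),
        ∃ C : ℝ, Tendsto (fun N : ℕ => ⨆ r ∈ Icc 0 t, ((N + 1 : ℕ) : ℝ≥0∞) *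
          localGibbsLaw σ a₀ u₀ θ₀ N (Φ N)
            {z | C * Real.sqrt (Real.log ((N : ℝ) + 2)) < ‖((Φ N).flow r z 0).2‖}) atTop (𝓝 0)

/-! ## Strengthen lens S⁺3 (deterministic / pathwise form) — FALSE in 3-D -/

/-- PATHWISE STRENGTHENING "no speed records": on every good orbit the maximal speed never
exceeds its initial value. TRUE for 1-D hard rods (velocities are exchanged, the velocity multiset
is invariant — the hard-rod sibling, BoldrighiniDobrushinSukhov1983 / DobrushinFritz1977), FALSE for
3-D hard spheres (one collision with `v ⟂ w`, impact direction along `v`, turns speeds `(1,1)` into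
`(0,√2)`): the transfer from the 1-D sibling dies at the first collision. Recorded as the typed
first non-transferring step (census §Transfer T2, §Strengthen S⁺3). -/
def NoSpeedRecords : Prop :=
  ∀ (σ : ℝ) (N : ℕ) (Φ : HardSphereFlow (Torus.geometry (Fin 3)) (hsDiameter σ N) (N + 1))
    (z : Config (N + 1) (Fin 3) T3), z ∈ Φ.good → ∀ c : ℝ, (∀ i, ‖(z i).2‖ ≤ c) →
      ∀ r : ℝ, 0 ≤ r → ∀ i, ‖(Φ.flow r z i).2‖ ≤ c

/-! ## Negation lens: the focusing witness (typed obstruction) -/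

/-- FOCUSING WITNESS (Guderley-type implosion profile): for SOME continuous positive profiles and
some macroscopic time `t` past the collapse, the maximal speed on `[0,t]` exceeds a POWER
`(N+1)^κ` with probability not tending to zero, for arbitrarily small reduced densities and some
flow family. Physically predicted (`κ ≈ 0.15`: post-shock temperature `∝ R^{-2(1-α)/α}`,
`α ≈ 0.688` for `γ = 5/3`, cut off at the mean free path `R ≍ (N+1)^{-1/3}`); its only known road to
a proof is (i) smooth implosion for the hard-sphere equation of state from `θ > 0` data (open:
MerleEtAl2022 / BuckmasterCaolaboraGomezserrano2025 / CaolaboraEtAl2025 are ideal-gas;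
ChenShkollerVicol2026's stable implosions have `θ(0) = 0`) and (ii) validity of Euler for the particle
system THROUGH the singular time down to mesoscopic scales — beyond the summit. -/
def FocusingWitness : Prop :=
  ∃ (a₀ θ₀ : T3 → ℝ) (u₀ : T3 → V3), Continuous a₀ ∧ Continuous θ₀ ∧ Continuous u₀ ∧
    (∀ x, 0 < a₀ x) ∧ (∀ x, 0 < θ₀ x) ∧ ∃ t : ℝ, 0 ≤ t ∧ ∃ κ : ℝ, 0 < κ ∧
      ∀ σ₀ : ℝ, 0 < σ₀ → ∃ σ : ℝ, 0 < σ ∧ σ < σ₀ ∧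
        ∃ Φ : (N : ℕ) → HardSphereFlow (Torus.geometry (Fin 3)) (hsDiameter σ N) (N + 1),
          ¬ Tendsto (fun N : ℕ => localGibbsLaw σ a₀ u₀ θ₀ N (Φ N)
              {z | ∃ r ∈ Icc 0 t, ∃ i, ((N + 1 : ℕ) : ℝ) ^ κ < ‖((Φ N).flow r z i).2‖}) atTop (𝓝 0)

/-- The (weaker, level-free) negation of the crux that the focusing witness would deliver:
for some admissible data NO constant `C` works. -/
def NoCapWitness : Prop :=
  ∃ (a₀ θ₀ : T3 → ℝ) (u₀ : T3 → V3), Continuous a₀ ∧ Continuous θ₀ ∧ Continuous u₀ ∧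
    (∀ x, 0 < a₀ x) ∧ (∀ x, 0 < θ₀ x) ∧
      ∀ σ₀ : ℝ, 0 < σ₀ → ∃ σ : ℝ, 0 < σ ∧ σ < σ₀ ∧ ∃ t : ℝ, 0 ≤ t ∧
        ∃ Φ : (N : ℕ) → HardSphereFlow (Torus.geometry (Fin 3)) (hsDiameter σ N) (N + 1),
          ∀ C : ℝ, ¬ Tendsto (fun N : ℕ => localGibbsLaw σ a₀ u₀ θ₀ N (Φ N)
              {z | ∃ r ∈ Icc 0 t, ∃ i, C * Real.sqrt (Real.log ((N : ℝ) + 2)) < ‖((Φ N).flow r z i).2‖})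
              atTop (𝓝 0)

/-- `NoCapWitness` is literally the negation of the crux (quantifier bookkeeping). -/
theorem not_maxSpeedBoundLog_of_noCapWitness (h : NoCapWitness) : ¬ MaxSpeedBoundLog := by
  intro hMS
  obtain ⟨a₀, θ₀, u₀, ha, hθ, hu, ha0, hθ0, H⟩ := h
  obtain ⟨σ₀, hσ₀, G⟩ := hMS a₀ θ₀ u₀ ha hθ hu ha0 hθ0
  obtain ⟨σ, hσ, hσ', t, ht, Φ, hΦ⟩ := H σ₀ hσ₀
  obtain ⟨C, hC⟩ := G σ hσ hσ' t ht Φ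
  exact hΦ C hC

end Summit.AtomisticToContinuum.HydrodynamicLimit.Cruxes.MaxSpeedBoundLog.Strategist
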